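import Literature.NumberTheory.LFunctions.SelbergMollifierThetaSum
import Literature.NumberTheory.LFunctions.SelbergMollifierLemma1014
import HarnessLib

/-!
# Titchmarsh §10.16: the off-diagonal terms `Σ₂ = O(X⁴ log³(1/δ) x^{-θ})`

Fifth support file for the proof of A. Selberg's positive-proportion theorem in the arrangement
of E. C. Titchmarsh, *The Theory of the Riemann Zeta-Function*, 2nd ed. (1986), §10.9–§10.22.
Everything here is PROVED; no named facts.

With `g(u) = ∑_{κ,λ<X} ∑_{m≥1} (β_κβ_λ/λ) exp(-π m²κ²λ⁻² u² (sin δ - i cos δ))` (§10.10; the kernel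
whose `L²` norms control `∫F²` and `∫|∫_t^{t+h}F|²`), the integral `J(x,θ) = ∫_x^∞ |g(u)|² u^{-θ} du`
splits (§10.11) into the diagonal terms `Σ₁` (`mκ/λ = nμ/ν`) and the off-diagonal terms

`Σ₂ = ∑' β_κβ_λβ_μβ_ν/(λν) ∫_x^∞ exp{-π(A+B)u² sin δ + iπ(A-B)u² cos δ} u^{-θ} du`,
`A = m²κ²/λ², B = n²μ²/ν², A ≠ B` (`Sigma2`).

**(10.16.1)**: `Σ₂ = O(X⁴ x^{-θ} log²(1/δ))`. We prove (`norm_Sigma2_le`)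
`‖Σ₂‖ ≤ C X⁴ (1 + log X + log(1/δ))³ x^{-θ}` for `X ≥ 2`, `0 < δ ≤ 1`, `x ≥ 1`, `θ ≥ 0` (one
logarithm weaker than the book, which is harmless: `X = δ^{-c}` with `c < 1/8` leaves a power of `δ`
to spare in §10.17).

## The argument (Titchmarsh §10.16, with two simplifications)

* `oscInt`: `|∫_x^∞ e^{zu²} u^{-θ} du| ≤ e^{re z·x²} x^{-1-θ}/|z|` for `re z < 0` (one integration by
  parts; Titchmarsh invokes the second mean-value theorem) (`norm_oscInt_le`).
* For the terms with `mκ/λ > nμ/ν`: `A - B ≥ √A(√A - √B) = (mκ/λ)(mκν - nλμ)/(λν)` and, `j = mκν - nλμ`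
  running through distinct positive integers `≤ mκν`, `∑_n 1/j ≤ 1 + log(mκν)` (Titchmarsh uses the
  finer `1 + O(log(mX)/(λμ))`); then `∑_m e^{-εm²}(1 + log m)/m = O(log²(1/ε))`, `ε = πκ²λ⁻² sin δ`
  (`tsum_exp_div_le`, `tsum_exp_log_div_le`, via the theta tail bound `S(ε) ≤ 5(1 + ε^{-1/2})`).
* Summing `λ²ν/κ · log²` against `|β_κβ_λβ_μβ_ν|/(λν) ≤ 1/(λν)` over `κ,λ,μ,ν < X` gives `X⁴ log³`.

## References

* [Titchmarsh1986] E. C. Titchmarsh, *The Theory of the Riemann Zeta-Function*, 2nd ed. revised by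
  D. R. Heath-Brown, Oxford 1986, §10.11, §10.16 (10.16.1).
-/

noncomputable section

open Real Complex MeasureTheory Set Filter Finset
open scoped Topology

namespace Literature.NumberTheory.LFunctions.SelbergMollifier

/-! ## §1 The oscillatory integral `∫_x^∞ e^{zu²} u^{-θ} du` -/

/-- The oscillatory integral `oscI z x θ = ∫_x^∞ e^{z u²} u^{-θ} du` (`re z < 0`).
[cite: Titchmarsh1986, §10.16] -/
def oscI (z : ℂ) (x θ : ℝ) : ℂ := ∫ u in Ioi x, cexp (z * ((u ^ 2 : ℝ) : ℂ)) * ((u ^ (-θ) : ℝ) : ℂ)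

/-- `‖e^{zu²}‖ = e^{re z · u²}`. [folklore] -/
theorem norm_cexp_mul_sq (z : ℂ) (u : ℝ) : ‖cexp (z * ((u ^ 2 : ℝ) : ℂ))‖ = Real.exp (z.re * u ^ 2) := by
  rw [Complex.norm_exp, Complex.re_mul_ofReal]

/-- The integrand is continuous on `(0, ∞)`. [folklore] -/
theorem continuousOn_oscIntegrand (z : ℂ) (a : ℝ) :
    ContinuousOn (fun u : ℝ ↦ cexp (z * ((u ^ 2 : ℝ) : ℂ)) * ((u ^ a : ℝ) : ℂ)) (Ioi 0) := by
  refine ContinuousOn.mul (Continuous.continuousOn (by fun_prop)) ?_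
  exact Complex.continuous_ofReal.comp_continuousOn (continuousOn_id.rpow_const fun u hu ↦ Or.inl (ne_of_gt hu))

/-- Pointwise bound on `(x,∞)`, `x ≥ 1`, `re z < 0`, `a ≤ 0`: `‖e^{zu²}u^a‖ ≤ e^{(re z·x)u}`. [folklore] -/
theorem norm_oscIntegrand_le {z : ℂ} (hz : z.re < 0) {x a : ℝ} (hx : 1 ≤ x) (ha : a ≤ 0) {u : ℝ} (hu : x < u) :
    ‖cexp (z * ((u ^ 2 : ℝ) : ℂ)) * ((u ^ a : ℝ) : ℂ)‖ ≤ Real.exp (z.re * x * u) := by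
  have hu1 : 1 ≤ u := by linarith
  rw [norm_mul, norm_cexp_mul_sq, Complex.norm_real, Real.norm_eq_abs, abs_of_nonneg (by positivity)]
  have h1 : u ^ a ≤ 1 := Real.rpow_le_one_of_one_le_of_nonpos hu1 ha
  have h2 : Real.exp (z.re * u ^ 2) ≤ Real.exp (z.re * x * u) :=
    Real.exp_le_exp.mpr (by nlinarith [mul_nonneg (by linarith : (0:ℝ) ≤ u - x) (by linarith : (0:ℝ) ≤ u)])
  calc Real.exp (z.re * u ^ 2) * u ^ a ≤ Real.exp (z.re * u ^ 2) * 1 :=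
        mul_le_mul_of_nonneg_left h1 (Real.exp_pos _).le
    _ ≤ _ := by rw [mul_one]; exact h2

/-- Integrability of the integrand on `(x, ∞)`, `x ≥ 1`, for `re z < 0`, `a ≤ 0`. [folklore] -/
theorem integrableOn_oscIntegrand {z : ℂ} (hz : z.re < 0) {x a : ℝ} (hx : 1 ≤ x) (ha : a ≤ 0) :
    IntegrableOn (fun u : ℝ ↦ cexp (z * ((u ^ 2 : ℝ) : ℂ)) * ((u ^ a : ℝ) : ℂ)) (Ioi x) := by
  have hx0 : 0 < x := by linarith
  have hc : z.re * x < 0 := mul_neg_of_neg_of_pos hz hx0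
  refine Integrable.mono' (integrableOn_exp_mul_Ioi hc x)
    (((continuousOn_oscIntegrand z a).mono (Ioi_subset_Ioi hx0.le)).aestronglyMeasurable measurableSet_Ioi) ?_
  exact (ae_restrict_iff' measurableSet_Ioi).mpr (Eventually.of_forall fun u hu ↦ norm_oscIntegrand_le hz hx ha hu)

/-- **Crude bound**: `‖∫_x^∞ e^{zu²}u^{-θ}‖ ≤ e^{re z·x²}/(|re z| x)` (`x ≥ 1`, `θ ≥ 0`). [folklore] -/
theorem norm_oscI_le_crude {z : ℂ} (hz : z.re < 0) {x θ : ℝ} (hx : 1 ≤ x) (hθ : 0 ≤ θ) :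
    ‖oscI z x θ‖ ≤ Real.exp (z.re * x ^ 2) / (|z.re| * x) := by
  have hx0 : 0 < x := by linarith
  have hc : z.re * x < 0 := mul_neg_of_neg_of_pos hz hx0
  calc ‖oscI z x θ‖ ≤ ∫ u in Ioi x, Real.exp (z.re * x * u) := by
        refine norm_integral_le_of_norm_le (integrableOn_exp_mul_Ioi hc x) ?_
        exact (ae_restrict_iff' measurableSet_Ioi).mpr (Eventually.of_forall fun u hu ↦
          norm_oscIntegrand_le hz hx (by linarith) hu)
    _ = Real.exp (z.re * x ^ 2) / (|z.re| * x) := by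
        rw [integral_exp_mul_Ioi hc, abs_of_neg hz]
        rw [show z.re * x * x = z.re * x ^ 2 by ring]
        have hzre : z.re ≠ 0 := hz.ne
        field_simp

/-- **The oscillatory bound** (one integration by parts):
`‖∫_x^∞ e^{zu²} u^{-θ} du‖ ≤ e^{re z·x²} x^{-1-θ}/‖z‖` for `re z < 0`, `x ≥ 1`, `θ ≥ 0`.
[cite: Titchmarsh1986, §10.16] -/
theorem norm_oscI_le {z : ℂ} (hz : z.re < 0) {x θ : ℝ} (hx : 1 ≤ x) (hθ : 0 ≤ θ) :
    ‖oscI z x θ‖ ≤ Real.exp (z.re * x ^ 2) * x ^ (-1 - θ) / ‖z‖ := by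
  have hx0 : 0 < x := by linarith
  have hz0 : z ≠ 0 := fun h ↦ by simp [h] at hz
  have hznorm : 0 < ‖z‖ := norm_pos_iff.mpr hz0
  -- the primitive `F(u) = e^{zu²} u^{-1-θ}/(2z)` and its derivative
  set F : ℝ → ℂ := fun u ↦ cexp (z * ((u ^ 2 : ℝ) : ℂ)) * ((u ^ (-1 - θ) : ℝ) : ℂ) / (2 * z) with hF
  set G : ℝ → ℂ := fun u ↦ cexp (z * ((u ^ 2 : ℝ) : ℂ)) * ((u ^ (-2 - θ) : ℝ) : ℂ) with hG
  set F' : ℝ → ℂ := fun u ↦ cexp (z * ((u ^ 2 : ℝ) : ℂ)) * ((u ^ (-θ) : ℝ) : ℂ) +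
    ((-1 - θ) / (2 * z) : ℂ) * G u with hF'
  have hderiv : ∀ u ∈ Ioi x, HasDerivAt F (F' u) u := by
    intro u hu
    have hu0 : 0 < u := hx0.trans hu
    have h1 : HasDerivAt (fun u : ℝ ↦ z * ((u ^ 2 : ℝ) : ℂ)) (z * (((2 * u : ℝ)) : ℂ)) u := by
      have := ((hasDerivAt_pow 2 u).ofReal_comp).const_mul z
      simpa using this
    have h2 : HasDerivAt (fun u : ℝ ↦ cexp (z * ((u ^ 2 : ℝ) : ℂ))) (cexp (z * ((u ^ 2 : ℝ) : ℂ)) * (z * (((2 * u : ℝ)) : ℂ))) u :=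
      h1.cexp
    have h3 : HasDerivAt (fun u : ℝ ↦ ((u ^ (-1 - θ) : ℝ) : ℂ)) ((((-1 - θ) * u ^ (-1 - θ - 1) : ℝ)) : ℂ) u :=
      (Real.hasDerivAt_rpow_const (Or.inl hu0.ne')).ofReal_comp
    have h4 := (h2.mul h3).div_const (2 * z)
    refine h4.congr_deriv ?_
    simp only [hF', hG]
    have hpow1 : (((2 * u : ℝ)) : ℂ) * ((u ^ (-1 - θ) : ℝ) : ℂ) = 2 * ((u ^ (-θ) : ℝ) : ℂ) := by
      rw [show (-θ : ℝ) = 1 + (-1 - θ) by ring, Real.rpow_add hu0, Real.rpow_one]; push_cast; ring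
    rw [show (-1 - θ - 1 : ℝ) = -2 - θ by ring, add_div]
    congr 1
    · rw [show cexp (z * ((u ^ 2 : ℝ) : ℂ)) * (z * (((2 * u : ℝ)) : ℂ)) * ((u ^ (-1 - θ) : ℝ) : ℂ) =
          z * cexp (z * ((u ^ 2 : ℝ) : ℂ)) * ((((2 * u : ℝ)) : ℂ) * ((u ^ (-1 - θ) : ℝ) : ℂ)) by ring, hpow1]
      field_simp
    · push_cast
      ring
  -- integrability of `F'`
  have hint1 : IntegrableOn (fun u : ℝ ↦ cexp (z * ((u ^ 2 : ℝ) : ℂ)) * ((u ^ (-θ) : ℝ) : ℂ)) (Ioi x) :=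
    integrableOn_oscIntegrand hz hx (by linarith)
  have hGbound : ∀ u ∈ Ioi x, ‖G u‖ ≤ Real.exp (z.re * x ^ 2) * u ^ (-2 - θ) := by
    intro u hu
    have hxu : x < u := hu
    have hu0 : 0 < u := hx0.trans hxu
    rw [hG, norm_mul, norm_cexp_mul_sq, Complex.norm_real, Real.norm_eq_abs, abs_of_nonneg (by positivity)]
    refine mul_le_mul_of_nonneg_right (Real.exp_le_exp.mpr ?_) (by positivity)
    have : x ^ 2 ≤ u ^ 2 := by nlinarith [le_of_lt hxu]
    nlinarith
  have hintG : IntegrableOn G (Ioi x) := by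
    refine Integrable.mono' ((integrableOn_Ioi_rpow_of_lt (by linarith : (-2 - θ : ℝ) < -1) hx0).const_mul
      (Real.exp (z.re * x ^ 2)))
      (((continuousOn_oscIntegrand z (-2 - θ)).mono (Ioi_subset_Ioi hx0.le)).aestronglyMeasurable measurableSet_Ioi) ?_
    exact (ae_restrict_iff' measurableSet_Ioi).mpr (Eventually.of_forall hGbound)
  have hint : IntegrableOn F' (Ioi x) := hint1.add (hintG.const_mul _)
  -- limits of `F`
  have hcont : ContinuousWithinAt F (Ici x) x := by
    have : ContinuousAt F x := by
      have hc : ContinuousOn F (Ioi 0) := (continuousOn_oscIntegrand z (-1 - θ)).div_const _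
      exact hc.continuousAt (Ioi_mem_nhds hx0)
    exact this.continuousWithinAt
  have hlim : Tendsto F atTop (𝓝 0) := by
    rw [tendsto_zero_iff_norm_tendsto_zero]
    have hbound : ∀ᶠ u in atTop, ‖F u‖ ≤ u ^ (-1 - θ) / (2 * ‖z‖) := by
      filter_upwards [eventually_ge_atTop x] with u hu
      have hu0 : 0 < u := by linarith
      rw [hF, norm_div, norm_mul, norm_cexp_mul_sq, Complex.norm_real, Real.norm_eq_abs,
        abs_of_nonneg (by positivity), norm_mul, Complex.norm_ofNat]
      refine div_le_div_of_nonneg_right ?_ (by positivity)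
      have : Real.exp (z.re * u ^ 2) ≤ 1 := Real.exp_le_one_iff.mpr (by nlinarith)
      calc Real.exp (z.re * u ^ 2) * u ^ (-1 - θ) ≤ 1 * u ^ (-1 - θ) :=
            mul_le_mul_of_nonneg_right this (by positivity)
        _ = _ := one_mul _
    have hlim0 : Tendsto (fun u : ℝ ↦ u ^ (-1 - θ) / (2 * ‖z‖)) atTop (𝓝 0) := by
      have := (tendsto_rpow_neg_atTop (y := 1 + θ) (by linarith)).div_const (2 * ‖z‖)
      rw [zero_div] at this
      refine this.congr fun u ↦ ?_
      rw [show (-(1 + θ) : ℝ) = -1 - θ by ring]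
    exact squeeze_zero' (Eventually.of_forall fun u ↦ norm_nonneg _) hbound hlim0
  -- FTC on `[x, ∞)`
  have hFTC := integral_Ioi_of_hasDerivAt_of_tendsto hcont hderiv hint hlim
  have hsplit : ∫ u in Ioi x, F' u = oscI z x θ + ((-1 - θ) / (2 * z) : ℂ) * ∫ u in Ioi x, G u := by
    rw [hF', integral_add hint1 (hintG.const_mul _), integral_const_mul]
    rfl
  have hosc : oscI z x θ = -F x - ((-1 - θ) / (2 * z) : ℂ) * ∫ u in Ioi x, G u := by
    have := hFTC; rw [hsplit, zero_sub] at this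
    linear_combination this
  -- bounds
  have hFx : ‖F x‖ = Real.exp (z.re * x ^ 2) * x ^ (-1 - θ) / (2 * ‖z‖) := by
    rw [hF, norm_div, norm_mul, norm_cexp_mul_sq, Complex.norm_real, Real.norm_eq_abs,
      abs_of_nonneg (by positivity), norm_mul, Complex.norm_ofNat]
  have hGint : ‖∫ u in Ioi x, G u‖ ≤ Real.exp (z.re * x ^ 2) * (x ^ (-1 - θ) / (1 + θ)) := by
    calc ‖∫ u in Ioi x, G u‖ ≤ ∫ u in Ioi x, Real.exp (z.re * x ^ 2) * u ^ (-2 - θ) :=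
          norm_integral_le_of_norm_le ((integrableOn_Ioi_rpow_of_lt (by linarith : (-2 - θ : ℝ) < -1) hx0).const_mul _)
            ((ae_restrict_iff' measurableSet_Ioi).mpr (Eventually.of_forall hGbound))
      _ = Real.exp (z.re * x ^ 2) * (x ^ (-1 - θ) / (1 + θ)) := by
          rw [integral_const_mul, integral_Ioi_rpow_of_lt (by linarith) hx0]
          congr 1
          rw [show (-2 - θ + 1 : ℝ) = -1 - θ by ring]
          have hne1 : (-1 - θ : ℝ) ≠ 0 := (by linarith : (-1 - θ : ℝ) < 0).ne
          have hne2 : (1 + θ : ℝ) ≠ 0 := (by linarith : (0 : ℝ) < 1 + θ).ne'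
          rw [div_eq_div_iff hne1 hne2]
          ring
  have hcoef : ‖((-1 - θ) / (2 * z) : ℂ)‖ = (1 + θ) / (2 * ‖z‖) := by
    rw [norm_div, norm_mul, Complex.norm_ofNat,
      show ((-1 - θ : ℂ)) = (((-1 - θ : ℝ)) : ℂ) by push_cast; ring, Complex.norm_real, Real.norm_eq_abs,
      abs_of_neg (by linarith : (-1 - θ : ℝ) < 0)]
    ring
  calc ‖oscI z x θ‖ = ‖-F x - ((-1 - θ) / (2 * z) : ℂ) * ∫ u in Ioi x, G u‖ := by rw [hosc]
    _ ≤ ‖F x‖ + ‖((-1 - θ) / (2 * z) : ℂ)‖ * ‖∫ u in Ioi x, G u‖ := by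
        refine (norm_sub_le _ _).trans ?_
        rw [norm_neg, norm_mul]
    _ ≤ Real.exp (z.re * x ^ 2) * x ^ (-1 - θ) / (2 * ‖z‖) +
          (1 + θ) / (2 * ‖z‖) * (Real.exp (z.re * x ^ 2) * (x ^ (-1 - θ) / (1 + θ))) := by
        rw [hFx, hcoef]
        gcongr
    _ = Real.exp (z.re * x ^ 2) * x ^ (-1 - θ) / ‖z‖ := by
        field_simp
        ring

/-! ## §2 The data of `Σ₂`: coefficients, frequencies, phases -/

/-- `c_p = β_κ β_λ / λ` for `p = (κ, λ)` (the coefficients of `g`). [cite: Titchmarsh1986, §10.10] -/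
def gCoeff (X : ℝ) (p : ℕ × ℕ) : ℝ := selbergBeta X p.1 * selbergBeta X p.2 / p.2

/-- `|c_p| ≤ 1/λ` on the mollifier range (`|β| ≤ 1`). [cite: Titchmarsh1986, §10.9] -/
theorem abs_gCoeff_le {X : ℝ} {p : ℕ × ℕ} (hp : p ∈ mollRange X ×ˢ mollRange X) :
    |gCoeff X p| ≤ 1 / p.2 := by
  obtain ⟨h1, h2⟩ := Finset.mem_product.mp hp
  have hl : (0 : ℝ) < p.2 := by exact_mod_cast (mem_mollRange.mp h2).1
  rw [gCoeff, abs_div, abs_mul, abs_of_pos hl]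
  refine div_le_div_of_nonneg_right ?_ hl.le
  calc |selbergBeta X p.1| * |selbergBeta X p.2| ≤ 1 * 1 :=
        mul_le_mul (abs_selbergBeta_le_one h1) (abs_selbergBeta_le_one h2) (abs_nonneg _) zero_le_one
    _ = 1 := one_mul 1

/-- `√A_{p,m} = (m+1) κ/λ`. [cite: Titchmarsh1986, §10.11] -/
def gRoot (p : ℕ × ℕ) (m : ℕ) : ℝ := ((m : ℝ) + 1) * p.1 / p.2

/-- `A_{p,m} = (m+1)² κ²/λ²`. [cite: Titchmarsh1986, §10.11] -/
def gFreq (p : ℕ × ℕ) (m : ℕ) : ℝ := gRoot p m ^ 2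

/-- The phase `z = -π(A+B) sin δ + iπ(A-B) cos δ`. [cite: Titchmarsh1986, §10.11] -/
def oscPhase (δ A B : ℝ) : ℂ :=
  ((-(π * (A + B) * Real.sin δ) : ℝ) : ℂ) + ((π * (A - B) * Real.cos δ : ℝ) : ℂ) * I

/-- `re z = -π(A+B) sin δ`. [folklore] -/
theorem oscPhase_re (δ A B : ℝ) : (oscPhase δ A B).re = -(π * (A + B) * Real.sin δ) := by
  unfold oscPhase
  simp only [Complex.add_re, Complex.ofReal_re, Complex.mul_re, Complex.I_re, Complex.I_im, Complex.ofReal_im]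
  ring

/-- `im z = π(A-B) cos δ`. [folklore] -/
theorem oscPhase_im (δ A B : ℝ) : (oscPhase δ A B).im = π * (A - B) * Real.cos δ := by
  unfold oscPhase
  simp only [Complex.add_im, Complex.ofReal_im, Complex.mul_im, Complex.I_re, Complex.I_im, Complex.ofReal_re]
  ring

/-- `|im z| ≤ ‖z‖`. [folklore] -/
theorem abs_im_le_norm_oscPhase (δ A B : ℝ) : |π * (A - B) * Real.cos δ| ≤ ‖oscPhase δ A B‖ := by
  rw [← oscPhase_im]; exact Complex.abs_im_le_norm _

/-- **The off-diagonal terms `Σ₂`** of `J(x,θ) = ∫_x^∞ |g|² u^{-θ}` (Titchmarsh §10.11: "and `Σ₂` the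
remainder"), as a sum over `p = (κ,λ)`, `p' = (μ,ν)` and `(m, n)` (shifted by one) of
`c_p c_{p'} ∫_x^∞ exp{-π(A+B)u² sin δ + iπ(A-B)u² cos δ} u^{-θ} du`, `A = A_{p,m}`, `B = A_{p',n}`, over the
pairs with `(m+1)κν ≠ (n+1)μλ`. [cite: Titchmarsh1986, §10.11, §10.16] -/
def Sigma2 (X δ x θ : ℝ) : ℂ :=
  ∑ p ∈ mollRange X ×ˢ mollRange X, ∑ p' ∈ mollRange X ×ˢ mollRange X, ∑' mn : ℕ × ℕ,
    if (mn.1 + 1) * p.1 * p'.2 = (mn.2 + 1) * p'.1 * p.2 then 0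
    else ((gCoeff X p * gCoeff X p' : ℝ) : ℂ) * oscI (oscPhase δ (gFreq p mn.1) (gFreq p' mn.2)) x θ

/-! ## §3 Elementary facts about the frequencies -/

section Freq

variable {X : ℝ} {p p' : ℕ × ℕ}

/-- Positivity of the entries of `p ∈ mollRange X ×ˢ mollRange X`. [folklore] -/
theorem pos_of_mem_prod (hp : p ∈ mollRange X ×ˢ mollRange X) : (0 : ℝ) < p.1 ∧ (0 : ℝ) < p.2 := by
  obtain ⟨h1, h2⟩ := Finset.mem_product.mp hp
  exact ⟨by exact_mod_cast (mem_mollRange.mp h1).1, by exact_mod_cast (mem_mollRange.mp h2).1⟩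

/-- Entries are `< X`. [folklore] -/
theorem lt_of_mem_prod (hp : p ∈ mollRange X ×ˢ mollRange X) : (p.1 : ℝ) < X ∧ (p.2 : ℝ) < X := by
  obtain ⟨h1, h2⟩ := Finset.mem_product.mp hp
  exact ⟨(mem_mollRange.mp h1).2, (mem_mollRange.mp h2).2⟩

/-- `gRoot p m > 0`. [folklore] -/
theorem gRoot_pos (hp : p ∈ mollRange X ×ˢ mollRange X) (m : ℕ) : 0 < gRoot p m := by
  obtain ⟨h1, h2⟩ := pos_of_mem_prod hp
  unfold gRoot; positivity

/-- `gRoot p m ≥ 1/λ ≥ 1/X`-type lower bound: `gRoot p m ≥ 1/p.2`. [folklore] -/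
theorem inv_le_gRoot (hp : p ∈ mollRange X ×ˢ mollRange X) (m : ℕ) : (p.2 : ℝ)⁻¹ ≤ gRoot p m := by
  obtain ⟨h1, h2⟩ := pos_of_mem_prod hp
  have hκ : (1 : ℝ) ≤ p.1 := by exact_mod_cast (mem_mollRange.mp (Finset.mem_product.mp hp).1).1
  rw [gRoot, inv_eq_one_div, div_le_div_iff₀ h2 h2]
  have hm1 : (1 : ℝ) ≤ ((m : ℝ) + 1) * p.1 := by nlinarith [m.cast_nonneg (α := ℝ)]
  nlinarith [mul_le_mul_of_nonneg_right hm1 h2.le]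

/-- The difference of roots: `gRoot p m - gRoot p' n = ((m+1)κν - (n+1)μλ)/(λν)`. [cite: Titchmarsh1986, §10.16] -/
theorem gRoot_sub_gRoot (hp : p ∈ mollRange X ×ˢ mollRange X) (hp' : p' ∈ mollRange X ×ˢ mollRange X) (m n : ℕ) :
    gRoot p m - gRoot p' n =
      ((((m : ℝ) + 1) * p.1 * p'.2) - (((n : ℝ) + 1) * p'.1 * p.2)) / ((p.2 : ℝ) * p'.2) := by
  obtain ⟨_, h2⟩ := pos_of_mem_prod hp
  obtain ⟨_, h2'⟩ := pos_of_mem_prod hp'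
  unfold gRoot
  field_simp

/-- The diagonal condition: `(m+1)κν = (n+1)μλ ↔ gRoot p m = gRoot p' n`. [folklore] -/
theorem diag_iff (hp : p ∈ mollRange X ×ˢ mollRange X) (hp' : p' ∈ mollRange X ×ˢ mollRange X) (m n : ℕ) :
    (m + 1) * p.1 * p'.2 = (n + 1) * p'.1 * p.2 ↔ gRoot p m = gRoot p' n := by
  obtain ⟨_, h2⟩ := pos_of_mem_prod hp
  obtain ⟨_, h2'⟩ := pos_of_mem_prod hp'
  rw [← sub_eq_zero (a := gRoot p m), gRoot_sub_gRoot hp hp', div_eq_zero_iff, sub_eq_zero]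
  constructor
  · intro h; left; exact_mod_cast h
  · rintro (h | h)
    · exact_mod_cast h
    · exfalso; exact (mul_pos h2 h2').ne' h

/-- The ordering condition: `gRoot p' n < gRoot p m ↔ (n+1)μλ < (m+1)κν`. [folklore] -/
theorem gRoot_lt_iff (hp : p ∈ mollRange X ×ˢ mollRange X) (hp' : p' ∈ mollRange X ×ˢ mollRange X) (m n : ℕ) :
    gRoot p' n < gRoot p m ↔ (n + 1) * p'.1 * p.2 < (m + 1) * p.1 * p'.2 := by
  obtain ⟨_, h2⟩ := pos_of_mem_prod hp
  obtain ⟨_, h2'⟩ := pos_of_mem_prod hp'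
  rw [← sub_pos, gRoot_sub_gRoot hp hp', div_pos_iff_of_pos_right (mul_pos h2 h2'), sub_pos]
  constructor
  · intro h; exact_mod_cast h
  · intro h; exact_mod_cast h

/-- Off the diagonal, `|A - B| ≥ λ^{-2}ν^{-1}`, i.e. `1/|A-B| ≤ λ²ν`. [folklore] -/
theorem inv_abs_sub_le (hp : p ∈ mollRange X ×ˢ mollRange X) (hp' : p' ∈ mollRange X ×ˢ mollRange X)
    {m n : ℕ} (hne : (m + 1) * p.1 * p'.2 ≠ (n + 1) * p'.1 * p.2) :
    |gFreq p m - gFreq p' n|⁻¹ ≤ (p.2 : ℝ) ^ 2 * p'.2 := by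
  obtain ⟨h1, h2⟩ := pos_of_mem_prod hp
  obtain ⟨h1', h2'⟩ := pos_of_mem_prod hp'
  have hr := gRoot_pos hp m
  have hr' := gRoot_pos hp' n
  have hdiff : gRoot p m - gRoot p' n ≠ 0 := fun h ↦ hne ((diag_iff hp hp' m n).mpr (sub_eq_zero.mp h))
  -- `|r - r'| ≥ 1/(λν)`: the numerator is a nonzero integer
  have hnum : (1 : ℝ) ≤ |(((m : ℝ) + 1) * p.1 * p'.2) - (((n : ℝ) + 1) * p'.1 * p.2)| := by
    have hint : (((m : ℝ) + 1) * p.1 * p'.2) - (((n : ℝ) + 1) * p'.1 * p.2) =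
        (((((m + 1) * p.1 * p'.2 : ℕ) : ℤ) - (((n + 1) * p'.1 * p.2 : ℕ) : ℤ) : ℤ) : ℝ) := by push_cast; ring
    rw [hint]
    have hne' : (((m + 1) * p.1 * p'.2 : ℕ) : ℤ) - (((n + 1) * p'.1 * p.2 : ℕ) : ℤ) ≠ 0 := by
      intro h; exact hne (by exact_mod_cast sub_eq_zero.mp h)
    exact_mod_cast Int.one_le_abs hne'
  have habs : ((p.2 : ℝ) * p'.2)⁻¹ ≤ |gRoot p m - gRoot p' n| := by
    rw [gRoot_sub_gRoot hp hp', abs_div, abs_of_pos (mul_pos h2 h2'), le_div_iff₀ (mul_pos h2 h2')]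
    rw [inv_mul_cancel₀ (mul_pos h2 h2').ne']
    exact hnum
  have hsum : (p.2 : ℝ)⁻¹ ≤ gRoot p m + gRoot p' n := by linarith [inv_le_gRoot hp m]
  have hfac : gFreq p m - gFreq p' n = (gRoot p m - gRoot p' n) * (gRoot p m + gRoot p' n) := by
    unfold gFreq; ring
  rw [hfac, abs_mul, abs_of_pos (by linarith : 0 < gRoot p m + gRoot p' n), mul_inv]
  calc |gRoot p m - gRoot p' n|⁻¹ * (gRoot p m + gRoot p' n)⁻¹ ≤ ((p.2 : ℝ) * p'.2) * p.2 := by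
        refine mul_le_mul ?_ ?_ (by positivity) (by positivity)
        · have := inv_anti₀ (by positivity) habs; rwa [inv_inv] at this
        · have := inv_anti₀ (by positivity) hsum; rwa [inv_inv] at this
    _ = (p.2 : ℝ) ^ 2 * p'.2 := by ring

/-- For `A > B`: `1/(A - B) ≤ 1/(√A(√A - √B))`. [cite: Titchmarsh1986, §10.16] -/
theorem inv_sub_le_of_lt (hp : p ∈ mollRange X ×ˢ mollRange X) (hp' : p' ∈ mollRange X ×ˢ mollRange X)
    {m n : ℕ} (hlt : gRoot p' n < gRoot p m) :
    (gFreq p m - gFreq p' n)⁻¹ ≤ (gRoot p m * (gRoot p m - gRoot p' n))⁻¹ := by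
  have hr := gRoot_pos hp m
  have hr' := gRoot_pos hp' n
  have hfac : gFreq p m - gFreq p' n = (gRoot p m - gRoot p' n) * (gRoot p m + gRoot p' n) := by
    unfold gFreq; ring
  rw [hfac]
  refine inv_anti₀ (mul_pos hr (by linarith)) ?_
  nlinarith

end Freq

/-! ## §4 The majorant `w = e^{-π(A+B) sin δ}/|A-B|` and its summability -/

/-- The real majorant of the `(m,n)` term (zero on the diagonal). [folklore] -/
def wMaj (δ : ℝ) (p p' : ℕ × ℕ) (mn : ℕ × ℕ) : ℝ :=
  if (mn.1 + 1) * p.1 * p'.2 = (mn.2 + 1) * p'.1 * p.2 then 0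
  else Real.exp (-(π * (gFreq p mn.1 + gFreq p' mn.2) * Real.sin δ)) * |gFreq p mn.1 - gFreq p' mn.2|⁻¹

/-- `w ≥ 0`. [folklore] -/
theorem wMaj_nonneg (δ : ℝ) (p p' : ℕ × ℕ) (mn : ℕ × ℕ) : 0 ≤ wMaj δ p p' mn := by
  unfold wMaj; split_ifs <;> positivity

/-- The Gaussian factors `a_m = e^{-π A_{p,m} sin δ}` are summable in `m` (`sin δ > 0`). [folklore] -/
theorem summable_exp_gFreq {X δ : ℝ} (hδ : 0 < Real.sin δ) {p : ℕ × ℕ} (hp : p ∈ mollRange X ×ˢ mollRange X) :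
    Summable fun m : ℕ ↦ Real.exp (-(π * gFreq p m * Real.sin δ)) := by
  obtain ⟨h1, h2⟩ := pos_of_mem_prod hp
  have hε : 0 < π * (p.1 / p.2) ^ 2 * Real.sin δ := by positivity
  refine (summable_thetaTail hε).congr fun m ↦ ?_
  unfold gFreq gRoot
  congr 1
  ring

/-- **`w` is summable over `ℕ × ℕ`** (bounded by `λ²ν a_m b_n`). [folklore] -/
theorem summable_wMaj {X δ : ℝ} (hδ : 0 < Real.sin δ) {p p' : ℕ × ℕ} (hp : p ∈ mollRange X ×ˢ mollRange X)
    (hp' : p' ∈ mollRange X ×ˢ mollRange X) : Summable (wMaj δ p p') := by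
  have hprod : Summable fun mn : ℕ × ℕ ↦ Real.exp (-(π * gFreq p mn.1 * Real.sin δ)) *
      Real.exp (-(π * gFreq p' mn.2 * Real.sin δ)) :=
    summable_mul_of_summable_norm (f := fun m : ℕ ↦ Real.exp (-(π * gFreq p m * Real.sin δ)))
      (g := fun n : ℕ ↦ Real.exp (-(π * gFreq p' n * Real.sin δ)))
      ((summable_exp_gFreq hδ hp).norm) ((summable_exp_gFreq hδ hp').norm)
  refine Summable.of_nonneg_of_le (wMaj_nonneg δ p p') (fun mn ↦ ?_) (hprod.mul_left ((p.2 : ℝ) ^ 2 * p'.2))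
  unfold wMaj
  split_ifs with h
  · positivity
  · rw [show -(π * (gFreq p mn.1 + gFreq p' mn.2) * Real.sin δ) =
        -(π * gFreq p mn.1 * Real.sin δ) + -(π * gFreq p' mn.2 * Real.sin δ) by ring, Real.exp_add, mul_comm]
    exact mul_le_mul_of_nonneg_right (inv_abs_sub_le hp hp' h) (by positivity)

/-- **Termwise bound for `Σ₂`**: `‖term‖ ≤ |c_p c_{p'}| x^{-θ} w/(π cos δ)`. [cite: Titchmarsh1986, §10.16] -/
theorem norm_Sigma2_term_le {X δ x θ : ℝ} (hδ : 0 < Real.sin δ) (hδ' : 0 < Real.cos δ) (hx : 1 ≤ x) (hθ : 0 ≤ θ)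
    {p p' : ℕ × ℕ} (hp : p ∈ mollRange X ×ˢ mollRange X) (hp' : p' ∈ mollRange X ×ˢ mollRange X) (mn : ℕ × ℕ) :
    ‖(if (mn.1 + 1) * p.1 * p'.2 = (mn.2 + 1) * p'.1 * p.2 then (0 : ℂ)
      else ((gCoeff X p * gCoeff X p' : ℝ) : ℂ) * oscI (oscPhase δ (gFreq p mn.1) (gFreq p' mn.2)) x θ)‖ ≤
      |gCoeff X p * gCoeff X p'| * x ^ (-θ) / (π * Real.cos δ) * wMaj δ p p' mn := by
  unfold wMaj
  split_ifs with h
  · simp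
  · have hx0 : 0 < x := by linarith
    have hr := gRoot_pos hp mn.1
    have hr' := gRoot_pos hp' mn.2
    have hA : 0 < gFreq p mn.1 := by unfold gFreq; exact pow_pos hr 2
    have hB : 0 < gFreq p' mn.2 := by unfold gFreq; exact pow_pos hr' 2
    have hAB : gFreq p mn.1 ≠ gFreq p' mn.2 := by
      intro hab
      apply h
      rw [diag_iff hp hp']
      unfold gFreq at hab
      exact (pow_left_inj₀ hr.le hr'.le two_ne_zero).mp hab
    set A := gFreq p mn.1 with hAdef
    set B := gFreq p' mn.2 with hBdef
    have hre : (oscPhase δ A B).re < 0 := by rw [oscPhase_re]; nlinarith [Real.pi_pos, mul_pos (mul_pos Real.pi_pos (add_pos hA hB)) hδ]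
    have hosc := norm_oscI_le hre hx hθ
    have hnormz : π * |A - B| * Real.cos δ ≤ ‖oscPhase δ A B‖ := by
      have := abs_im_le_norm_oscPhase δ A B
      rwa [abs_mul, abs_mul, abs_of_pos Real.pi_pos, abs_of_pos hδ'] at this
    have hzpos : 0 < π * |A - B| * Real.cos δ := by
      have : 0 < |A - B| := abs_pos.mpr (sub_ne_zero.mpr hAB); positivity
    rw [norm_mul, Complex.norm_real, Real.norm_eq_abs]
    refine (mul_le_mul_of_nonneg_left hosc (abs_nonneg _)).trans ?_
    rw [oscPhase_re]
    -- `e^{re z x²} ≤ e^{re z}`, `x^{-1-θ} ≤ x^{-θ}`, `1/‖z‖ ≤ 1/(π|A-B|cos δ)`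
    have h1 : Real.exp (-(π * (A + B) * Real.sin δ) * x ^ 2) ≤ Real.exp (-(π * (A + B) * Real.sin δ)) := by
      refine Real.exp_le_exp.mpr ?_
      have hx2 : 1 ≤ x ^ 2 := by nlinarith
      nlinarith [mul_pos (mul_pos Real.pi_pos (add_pos hA hB)) hδ]
    have h2 : x ^ (-1 - θ) ≤ x ^ (-θ) := Real.rpow_le_rpow_of_exponent_le hx (by linarith)
    calc |gCoeff X p * gCoeff X p'| * (Real.exp (-(π * (A + B) * Real.sin δ) * x ^ 2) * x ^ (-1 - θ) / ‖oscPhase δ A B‖)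
        ≤ |gCoeff X p * gCoeff X p'| * (Real.exp (-(π * (A + B) * Real.sin δ)) * x ^ (-θ) / (π * |A - B| * Real.cos δ)) := by
          gcongr
      _ = |gCoeff X p * gCoeff X p'| * x ^ (-θ) / (π * Real.cos δ) *
            (Real.exp (-(π * (A + B) * Real.sin δ)) * |A - B|⁻¹) := by
          field_simp

/-! ## §5 The `m`-sums `∑_m e^{-ε m²}(Λ + log m)/m = O((Λ + log(1/ε))²)` -/

/-- `S(ε) ≤ 5(1 + ε^{-1/2})` for `ε > 0` (theta tail). [folklore] -/
theorem thetaTail_le_five {ε : ℝ} (hε : 0 < ε) : thetaTail ε ≤ 5 * (1 + ε ^ (-(1 / 2 : ℝ))) := by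
  have hpow : 0 < ε ^ (-(1 / 2 : ℝ)) := Real.rpow_pos_of_pos hε _
  rcases le_or_gt ε 1 with h1 | h1
  · have hv : 0 < Real.sqrt ε := Real.sqrt_pos.mpr hε
    have hv1 : Real.sqrt ε ≤ 1 := Real.sqrt_le_one.mpr h1
    have h := abs_thetaTail_sq_sub_le hv hv1
    rw [Real.sq_sqrt hε.le, abs_le] at h
    have hsπ : Real.sqrt π ≤ 2 := by
      rw [Real.sqrt_le_left (by norm_num)]; linarith [Real.pi_lt_four]
    have heq : Real.sqrt π / (2 * Real.sqrt ε) ≤ ε ^ (-(1 / 2 : ℝ)) := by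
      rw [Real.sqrt_eq_rpow ε, div_le_iff₀ (by positivity)]
      have : ε ^ (-(1 / 2 : ℝ)) * (2 * ε ^ (1 / 2 : ℝ)) = 2 := by
        rw [mul_comm, mul_assoc, ← Real.rpow_add hε]; norm_num
      linarith
    linarith
  · have h := thetaTail_le_two_mul_exp h1.le
    have : Real.exp (-ε) ≤ 1 := Real.exp_le_one_iff.mpr (by linarith)
    linarith

/-- `∑_{m<M} 1/(m+1) = ∑_{i=1}^{M} 1/i`. [folklore] -/
theorem sum_range_inv_eq_sum_Icc (M : ℕ) :
    ∑ m ∈ Finset.range M, ((m : ℝ) + 1)⁻¹ = ∑ i ∈ Finset.Icc 1 M, (i : ℝ)⁻¹ := by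
  induction M with
  | zero => simp
  | succ M ih =>
    rw [Finset.sum_range_succ, Finset.sum_Icc_succ_top (by omega), ih]
    push_cast
    ring

/-- The cut-off `M₀ = ⌈ε^{-1/2}⌉ + 3`. [folklore] -/
def cutM (ε : ℝ) : ℕ := ⌈ε ^ (-(1 / 2 : ℝ))⌉₊ + 3

/-- `3 ≤ M₀`, `ε^{-1/2} ≤ M₀`, `M₀ ≤ ε^{-1/2} + 4`. [folklore] -/
theorem cutM_bounds {ε : ℝ} (hε : 0 < ε) :
    (3 : ℝ) ≤ cutM ε ∧ ε ^ (-(1 / 2 : ℝ)) ≤ cutM ε ∧ (cutM ε : ℝ) ≤ ε ^ (-(1 / 2 : ℝ)) + 4 := by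
  have hpow : 0 ≤ ε ^ (-(1 / 2 : ℝ)) := Real.rpow_nonneg hε.le _
  unfold cutM
  push_cast
  refine ⟨by linarith [Nat.cast_nonneg (α := ℝ) ⌈ε ^ (-(1 / 2 : ℝ))⌉₊], ?_, ?_⟩
  · linarith [Nat.le_ceil (ε ^ (-(1 / 2 : ℝ)))]
  · linarith [(Nat.ceil_lt_add_one hpow).le]

/-- **The weighted `m`-sum**: for `ε > 0` and `Λ ≥ 1`,
`∑_{m≥1} e^{-εm²}(Λ + log m)/m ≤ 12 (Λ + log M₀)²` with `M₀ = ⌈ε^{-1/2}⌉ + 3`. [cite: Titchmarsh1986, §10.16] -/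
theorem tsum_exp_weight_le {ε Λ : ℝ} (hε : 0 < ε) (hΛ : 1 ≤ Λ) :
    Summable (fun m : ℕ ↦ Real.exp (-ε * ((m : ℝ) + 1) ^ 2) * (Λ + Real.log ((m : ℝ) + 1)) / ((m : ℝ) + 1)) ∧
    ∑' m : ℕ, Real.exp (-ε * ((m : ℝ) + 1) ^ 2) * (Λ + Real.log ((m : ℝ) + 1)) / ((m : ℝ) + 1) ≤
      12 * (Λ + Real.log (cutM ε)) ^ 2 := by
  obtain ⟨hM3, hMε, hM4⟩ := cutM_bounds hε
  set M₀ := cutM ε with hM₀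
  have hM0 : (0 : ℝ) < M₀ := by linarith
  have hlogM : 1 ≤ Real.log M₀ := by
    rw [Real.le_log_iff_exp_le hM0]; have := Real.exp_one_lt_d9; linarith
  set ΛM := Λ + Real.log M₀ with hΛM
  have hΛM1 : 2 ≤ ΛM := by linarith
  set f : ℕ → ℝ := fun m ↦ Real.exp (-ε * ((m : ℝ) + 1) ^ 2) * (Λ + Real.log ((m : ℝ) + 1)) / ((m : ℝ) + 1) with hf
  have hf0 : ∀ m, 0 ≤ f m := fun m ↦ by
    have : 0 ≤ Real.log ((m : ℝ) + 1) := Real.log_nonneg (by linarith [m.cast_nonneg (α := ℝ)])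
    positivity
  -- the theta tail in our normalisation
  have htail : HasSum (fun m : ℕ ↦ Real.exp (-ε * ((m : ℝ) + 1) ^ 2)) (thetaTail ε) :=
    (hasSum_thetaTail hε).congr_fun fun m ↦ by ring_nf
  have htail5 := thetaTail_le_five hε
  -- termwise bounds: `f m ≤ Λ + log(m+1)` always (for the head) and `f m ≤ e^{-ε(m+1)²} ΛM/M₀` for `m + 1 > M₀`
  have hhead : ∀ m : ℕ, (m : ℝ) + 1 ≤ M₀ → f m ≤ ΛM * ((m : ℝ) + 1)⁻¹ := by
    intro m hm
    have hm0 : (0 : ℝ) < (m : ℝ) + 1 := by positivity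
    have hexp : Real.exp (-ε * ((m : ℝ) + 1) ^ 2) ≤ 1 := Real.exp_le_one_iff.mpr (by nlinarith)
    have hlog : Real.log ((m : ℝ) + 1) ≤ Real.log M₀ := Real.log_le_log hm0 hm
    have hlog0 : 0 ≤ Real.log ((m : ℝ) + 1) := Real.log_nonneg (by linarith [m.cast_nonneg (α := ℝ)])
    change Real.exp (-ε * ((m : ℝ) + 1) ^ 2) * (Λ + Real.log ((m : ℝ) + 1)) / ((m : ℝ) + 1) ≤ _
    rw [div_eq_mul_inv]
    refine mul_le_mul ?_ le_rfl (by positivity) (by linarith)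
    calc Real.exp (-ε * ((m : ℝ) + 1) ^ 2) * (Λ + Real.log ((m : ℝ) + 1)) ≤ 1 * (Λ + Real.log M₀) :=
          mul_le_mul hexp (by linarith) (by positivity) zero_le_one
      _ = ΛM := one_mul _
  have htail_term : ∀ m : ℕ, (M₀ : ℝ) ≤ (m : ℝ) + 1 →
      f m ≤ ΛM / M₀ * Real.exp (-ε * ((m : ℝ) + 1) ^ 2) := by
    intro m hm
    have hm0 : (0 : ℝ) < (m : ℝ) + 1 := by positivity
    -- `log(m+1)/(m+1) ≤ log M₀/M₀` and `1/(m+1) ≤ 1/M₀`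
    have hanti := Real.log_div_self_antitoneOn (a := (M₀ : ℝ)) (b := (m : ℝ) + 1)
      (by show Real.exp 1 ≤ (M₀ : ℝ); have := Real.exp_one_lt_d9; linarith)
      (by show Real.exp 1 ≤ (m : ℝ) + 1; have := Real.exp_one_lt_d9; linarith) hm
    have hinv : ((m : ℝ) + 1)⁻¹ ≤ (M₀ : ℝ)⁻¹ := inv_anti₀ hM0 hm
    change Real.exp (-ε * ((m : ℝ) + 1) ^ 2) * (Λ + Real.log ((m : ℝ) + 1)) / ((m : ℝ) + 1) ≤ _
    rw [show Real.exp (-ε * ((m : ℝ) + 1) ^ 2) * (Λ + Real.log ((m : ℝ) + 1)) / ((m : ℝ) + 1) =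
      Real.exp (-ε * ((m : ℝ) + 1) ^ 2) * (Λ * ((m : ℝ) + 1)⁻¹ + Real.log ((m : ℝ) + 1) / ((m : ℝ) + 1)) by
        field_simp]
    rw [show ΛM / M₀ * Real.exp (-ε * ((m : ℝ) + 1) ^ 2) =
      Real.exp (-ε * ((m : ℝ) + 1) ^ 2) * (Λ * (M₀ : ℝ)⁻¹ + Real.log M₀ / M₀) by rw [hΛM]; field_simp]
    refine mul_le_mul_of_nonneg_left (add_le_add ?_ hanti) (Real.exp_pos _).le
    exact mul_le_mul_of_nonneg_left hinv (by linarith)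
  -- summability
  have hsum_tail : Summable fun m : ℕ ↦ ΛM / M₀ * Real.exp (-ε * ((m : ℝ) + 1) ^ 2) :=
    htail.summable.mul_left _
  have hsumm : Summable f := by
    refine Summable.of_nonneg_of_le hf0 (fun m ↦ ?_) (hsum_tail.add (summable_of_ne_finset_zero
      (s := Finset.range M₀) (f := fun m : ℕ ↦ if m < M₀ then ΛM * ((m : ℝ) + 1)⁻¹ else 0)
      (fun m hm ↦ by rw [Finset.mem_range] at hm; rw [if_neg hm])))
    by_cases hm : m < M₀
    · rw [if_pos hm]
      have : (m : ℝ) + 1 ≤ M₀ := by exact_mod_cast hm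
      have h := hhead m this
      have : 0 ≤ ΛM / M₀ * Real.exp (-ε * ((m : ℝ) + 1) ^ 2) := by positivity
      linarith
    · rw [if_neg hm, add_zero]
      have h' : (M₀ : ℝ) ≤ m := by exact_mod_cast not_lt.mp hm
      exact htail_term m (by linarith)
  refine ⟨hsumm, ?_⟩
  -- split the sum at `M₀`
  rw [← hsumm.sum_add_tsum_nat_add M₀]
  have hpart1 : ∑ m ∈ Finset.range M₀, f m ≤ ΛM * (1 + Real.log M₀) := by
    calc ∑ m ∈ Finset.range M₀, f m ≤ ∑ m ∈ Finset.range M₀, ΛM * ((m : ℝ) + 1)⁻¹ :=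
          Finset.sum_le_sum fun m hm ↦ hhead m (by exact_mod_cast Finset.mem_range.mp hm)
      _ = ΛM * ∑ i ∈ Finset.Icc 1 M₀, (i : ℝ)⁻¹ := by
          rw [← sum_range_inv_eq_sum_Icc M₀, Finset.mul_sum]
      _ ≤ ΛM * (1 + Real.log M₀) := mul_le_mul_of_nonneg_left (sum_Icc_inv_le_log M₀) (by linarith)
  have hpart2 : ∑' m : ℕ, f (m + M₀) ≤ 10 * ΛM := by
    have hshift : Summable fun m : ℕ ↦ f (m + M₀) := (summable_nat_add_iff M₀).mpr hsumm
    have hshift2 : Summable fun m : ℕ ↦ ΛM / M₀ * Real.exp (-ε * (((m + M₀ : ℕ) : ℝ) + 1) ^ 2) :=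
      (summable_nat_add_iff (f := fun m : ℕ ↦ ΛM / M₀ * Real.exp (-ε * ((m : ℝ) + 1) ^ 2)) M₀).mpr hsum_tail
    calc ∑' m : ℕ, f (m + M₀) ≤ ∑' m : ℕ, ΛM / M₀ * Real.exp (-ε * (((m + M₀ : ℕ) : ℝ) + 1) ^ 2) := by
          refine hshift.tsum_le_tsum (fun m ↦ ?_) hshift2
          exact htail_term (m + M₀) (by push_cast; linarith [m.cast_nonneg (α := ℝ)])
      _ ≤ ∑' m : ℕ, ΛM / M₀ * Real.exp (-ε * ((m : ℝ) + 1) ^ 2) := by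
          refine hshift2.tsum_le_tsum (fun m ↦ ?_) hsum_tail
          refine mul_le_mul_of_nonneg_left (Real.exp_le_exp.mpr ?_) (by positivity)
          push_cast
          nlinarith [m.cast_nonneg (α := ℝ), mul_nonneg hε.le (mul_nonneg hM0.le hM0.le)]
      _ = ΛM / M₀ * thetaTail ε := by rw [tsum_mul_left, htail.tsum_eq]
      _ ≤ ΛM / M₀ * (5 * (1 + ε ^ (-(1 / 2 : ℝ)))) := mul_le_mul_of_nonneg_left htail5 (by positivity)
      _ ≤ 10 * ΛM := by
          rw [div_mul_eq_mul_div, div_le_iff₀ hM0]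
          have : 1 + ε ^ (-(1 / 2 : ℝ)) ≤ 2 * M₀ := by linarith
          nlinarith
  have hlogM' : Real.log M₀ ≤ ΛM := by linarith
  nlinarith [hpart1, hpart2, hlogM]

/-! ## §6 The inner sums over `n` and the bound for `T₁(p,p') = ∑_{r'_n < r_m} w` -/

section Tgt

variable {X δ : ℝ} {p p' : ℕ × ℕ}

/-- `T₁(p,p') = ∑_{(m,n) : √B_n < √A_m} w(m,n)` (the terms with `mκ/λ > nμ/ν`). [cite: Titchmarsh1986, §10.16] -/
def Tgt (δ : ℝ) (p p' : ℕ × ℕ) : ℝ :=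
  ∑' mn : ℕ × ℕ, if gRoot p' mn.2 < gRoot p mn.1 then wMaj δ p p' mn else 0

/-- The restricted majorant is between `0` and `w`. [folklore] -/
theorem ugt_nonneg_le (δ : ℝ) (p p' : ℕ × ℕ) (mn : ℕ × ℕ) :
    0 ≤ (if gRoot p' mn.2 < gRoot p mn.1 then wMaj δ p p' mn else 0) ∧
      (if gRoot p' mn.2 < gRoot p mn.1 then wMaj δ p p' mn else 0) ≤ wMaj δ p p' mn := by
  have := wMaj_nonneg δ p p' mn
  split_ifs <;> exact ⟨by positivity, by linarith⟩

/-- Summability of the restricted majorant. [folklore] -/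
theorem summable_ugt (hδ : 0 < Real.sin δ) (hp : p ∈ mollRange X ×ˢ mollRange X)
    (hp' : p' ∈ mollRange X ×ˢ mollRange X) :
    Summable fun mn : ℕ × ℕ ↦ if gRoot p' mn.2 < gRoot p mn.1 then wMaj δ p p' mn else 0 :=
  Summable.of_nonneg_of_le (fun mn ↦ (ugt_nonneg_le δ p p' mn).1) (fun mn ↦ (ugt_nonneg_le δ p p' mn).2)
    (summable_wMaj hδ hp hp')

/-- **The inner sum over `n`** (Titchmarsh: "`∑_n 1/(mκν - nλμ) ≤ 1 + …`"): for fixed `m`,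
`∑_n u(m,n) ≤ e^{-ε(m+1)²} λ²ν (1 + log((m+1)κν))/((m+1)κ)`, `ε = π(κ/λ)² sin δ`.
[cite: Titchmarsh1986, §10.16] -/
theorem tsum_ugt_fiber_le (hδ : 0 < Real.sin δ) (hp : p ∈ mollRange X ×ˢ mollRange X)
    (hp' : p' ∈ mollRange X ×ˢ mollRange X) (m : ℕ) :
    ∑' n : ℕ, (if gRoot p' n < gRoot p m then wMaj δ p p' (m, n) else 0) ≤
      Real.exp (-(π * gFreq p m * Real.sin δ)) *
        ((p.2 : ℝ) ^ 2 * p'.2 / (((m : ℝ) + 1) * p.1) * (1 + Real.log (((m : ℝ) + 1) * p.1 * p'.2))) := by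
  classical
  obtain ⟨h1, h2⟩ := pos_of_mem_prod hp
  obtain ⟨h1', h2'⟩ := pos_of_mem_prod hp'
  have hμ1 : 1 ≤ p'.1 := (mem_mollRange.mp (Finset.mem_product.mp hp').1).1
  have hl1 : 1 ≤ p.2 := (mem_mollRange.mp (Finset.mem_product.mp hp).2).1
  set M : ℕ := (m + 1) * p.1 * p'.2 with hM
  have hM0 : 0 < M := by
    have hκ1 : 1 ≤ p.1 := (mem_mollRange.mp (Finset.mem_product.mp hp).1).1
    have hν1 : 1 ≤ p'.2 := (mem_mollRange.mp (Finset.mem_product.mp hp').2).1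
    positivity
  have hMcast : (M : ℝ) = ((m : ℝ) + 1) * p.1 * p'.2 := by rw [hM]; push_cast; ring
  set S : Finset ℕ := (Finset.range M).filter fun n ↦ (n + 1) * p'.1 * p.2 < M with hS
  -- support of the summand
  have hsupp : ∀ n : ℕ, n ∉ S → (if gRoot p' n < gRoot p m then wMaj δ p p' (m, n) else 0) = 0 := by
    intro n hn
    rw [if_neg]
    intro hlt
    apply hn
    rw [hS, Finset.mem_filter, Finset.mem_range]
    have hlt' : (n + 1) * p'.1 * p.2 < M := (gRoot_lt_iff hp hp' m n).mp hlt
    refine ⟨?_, hlt'⟩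
    calc n < n + 1 := Nat.lt_succ_self n
      _ ≤ (n + 1) * p'.1 := Nat.le_mul_of_pos_right _ (by omega)
      _ ≤ (n + 1) * p'.1 * p.2 := Nat.le_mul_of_pos_right _ (by omega)
      _ < M := hlt'
  rw [tsum_eq_sum (s := S) hsupp]
  -- termwise bound on `S`
  set r := gRoot p m with hr
  have hrpos : 0 < r := gRoot_pos hp m
  have hterm : ∀ n ∈ S, (if gRoot p' n < gRoot p m then wMaj δ p p' (m, n) else 0) ≤
      Real.exp (-(π * gFreq p m * Real.sin δ)) * (r⁻¹ * (((p.2 : ℝ) * p'.2) *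
        ((M - (n + 1) * p'.1 * p.2 : ℕ) : ℝ)⁻¹)) := by
    intro n hn
    obtain ⟨_, hnM⟩ := Finset.mem_filter.mp hn
    have hlt : gRoot p' n < gRoot p m := (gRoot_lt_iff hp hp' m n).mpr hnM
    have hne : (m + 1) * p.1 * p'.2 ≠ (n + 1) * p'.1 * p.2 := by rw [← hM]; omega
    rw [if_pos hlt, wMaj, if_neg hne]
    have hAB : 0 < gFreq p m - gFreq p' n := by
      unfold gFreq; nlinarith [gRoot_pos hp' n]
    rw [abs_of_pos hAB]
    refine mul_le_mul (Real.exp_le_exp.mpr ?_) ((inv_sub_le_of_lt hp hp' hlt).trans (le_of_eq ?_))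
      (by positivity) (by positivity)
    · have : 0 ≤ π * gFreq p' n * Real.sin δ := by unfold gFreq; positivity
      nlinarith
    · rw [mul_inv, gRoot_sub_gRoot hp hp' m n, inv_div]
      congr 1
      rw [Nat.cast_sub hnM.le]
      push_cast
      rw [hMcast, div_eq_mul_inv]
  refine (Finset.sum_le_sum hterm).trans ?_
  rw [← Finset.mul_sum, ← Finset.mul_sum, ← Finset.mul_sum]
  refine mul_le_mul_of_nonneg_left ?_ (Real.exp_pos _).le
  -- the harmonic sum over the distinct positive integers `j(n) = M - (n+1)μλ`
  set j : ℕ → ℕ := fun n ↦ M - (n + 1) * p'.1 * p.2 with hj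
  have hinj : Set.InjOn j (S : Set ℕ) := by
    intro a ha b hb hab
    have ha' := (Finset.mem_filter.mp (Finset.mem_coe.mp ha)).2
    have hb' := (Finset.mem_filter.mp (Finset.mem_coe.mp hb)).2
    simp only [hj] at hab
    have hμl : 0 < p'.1 * p.2 := by positivity
    have : (a + 1) * p'.1 * p.2 = (b + 1) * p'.1 * p.2 := by omega
    have : (a + 1) * (p'.1 * p.2) = (b + 1) * (p'.1 * p.2) := by rw [← mul_assoc, ← mul_assoc]; exact this
    have := Nat.eq_of_mul_eq_mul_right hμl this
    omega
  have himg : S.image j ⊆ Finset.Icc 1 M := by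
    intro v hv
    obtain ⟨n, hn, rfl⟩ := Finset.mem_image.mp hv
    have hn' := (Finset.mem_filter.mp hn).2
    rw [Finset.mem_Icc]
    simp only [hj]
    omega
  have hharm : ∑ n ∈ S, ((M - (n + 1) * p'.1 * p.2 : ℕ) : ℝ)⁻¹ ≤ 1 + Real.log M := by
    show ∑ n ∈ S, ((j n : ℕ) : ℝ)⁻¹ ≤ _
    calc ∑ n ∈ S, ((j n : ℕ) : ℝ)⁻¹ = ∑ v ∈ S.image j, (v : ℝ)⁻¹ :=
          (Finset.sum_image (f := fun v : ℕ ↦ (v : ℝ)⁻¹) hinj).symm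
      _ ≤ ∑ v ∈ Finset.Icc 1 M, (v : ℝ)⁻¹ :=
          Finset.sum_le_sum_of_subset_of_nonneg himg fun v _ _ ↦ by positivity
      _ ≤ 1 + Real.log M := sum_Icc_inv_le_log M
  have hr' : r⁻¹ = (p.2 : ℝ) / (((m : ℝ) + 1) * p.1) := by
    rw [hr, gRoot, inv_div]
  have hlogM0 : 0 ≤ 1 + Real.log M := by
    have : 0 ≤ Real.log (M : ℝ) := Real.log_natCast_nonneg M
    linarith
  calc r⁻¹ * (((p.2 : ℝ) * p'.2) * ∑ n ∈ S, ((M - (n + 1) * p'.1 * p.2 : ℕ) : ℝ)⁻¹)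
      ≤ r⁻¹ * (((p.2 : ℝ) * p'.2) * (1 + Real.log M)) := by gcongr
    _ = (p.2 : ℝ) ^ 2 * p'.2 / (((m : ℝ) + 1) * p.1) * (1 + Real.log (((m : ℝ) + 1) * p.1 * p'.2)) := by
        rw [hr', hMcast]; field_simp

/-- **Bound for `T₁(p,p')`**: with `ε = π(κ/λ)² sin δ` and `M₀ = ⌈ε^{-1/2}⌉ + 3`,
`T₁(p,p') ≤ (λ²ν/κ) · 12 (1 + log(κν) + log M₀)²`. [cite: Titchmarsh1986, §10.16] -/
theorem Tgt_le (hδ : 0 < Real.sin δ) (hp : p ∈ mollRange X ×ˢ mollRange X) (hp' : p' ∈ mollRange X ×ˢ mollRange X) :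
    Tgt δ p p' ≤ (p.2 : ℝ) ^ 2 * p'.2 / p.1 *
      (12 * ((1 + Real.log ((p.1 : ℝ) * p'.2)) + Real.log (cutM (π * ((p.1 : ℝ) / p.2) ^ 2 * Real.sin δ))) ^ 2) := by
  obtain ⟨h1, h2⟩ := pos_of_mem_prod hp
  obtain ⟨h1', h2'⟩ := pos_of_mem_prod hp'
  have hκ1 : (1 : ℝ) ≤ p.1 := by exact_mod_cast (mem_mollRange.mp (Finset.mem_product.mp hp).1).1
  have hν1 : (1 : ℝ) ≤ p'.2 := by exact_mod_cast (mem_mollRange.mp (Finset.mem_product.mp hp').2).1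
  set ε : ℝ := π * ((p.1 : ℝ) / p.2) ^ 2 * Real.sin δ with hε
  have hε0 : 0 < ε := by positivity
  set Λ : ℝ := 1 + Real.log ((p.1 : ℝ) * p'.2) with hΛ
  have hΛ1 : 1 ≤ Λ := by
    have : 0 ≤ Real.log ((p.1 : ℝ) * p'.2) := Real.log_nonneg (by nlinarith)
    linarith
  obtain ⟨hwsum, hwle⟩ := tsum_exp_weight_le hε0 hΛ1
  have hsum := summable_ugt hδ hp hp'
  rw [Tgt, hsum.tsum_prod' (fun m ↦ ?_)]
  swap
  · -- each fibre is summable (bounded by the summable `w(m, ·)`)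
    exact ((summable_ugt hδ hp hp').comp_injective (Prod.mk_right_injective m))
  -- compare fibrewise with the weight sum
  have hfib : ∀ m : ℕ, ∑' n : ℕ, (if gRoot p' n < gRoot p m then wMaj δ p p' (m, n) else 0) ≤
      (p.2 : ℝ) ^ 2 * p'.2 / p.1 *
        (Real.exp (-ε * ((m : ℝ) + 1) ^ 2) * (Λ + Real.log ((m : ℝ) + 1)) / ((m : ℝ) + 1)) := by
    intro m
    refine (tsum_ugt_fiber_le hδ hp hp' m).trans (le_of_eq ?_)
    have hexp : -(π * gFreq p m * Real.sin δ) = -ε * ((m : ℝ) + 1) ^ 2 := by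
      rw [hε]; unfold gFreq gRoot; ring
    have hlog : Real.log (((m : ℝ) + 1) * p.1 * p'.2) = Real.log ((m : ℝ) + 1) + Real.log ((p.1 : ℝ) * p'.2) := by
      rw [mul_assoc, Real.log_mul (by positivity) (by positivity)]
    rw [hexp, hlog, hΛ]
    field_simp
    ring
  have hsumfib : Summable fun m : ℕ ↦ ∑' n : ℕ, (if gRoot p' n < gRoot p m then wMaj δ p p' (m, n) else 0) :=
    hsum.prod
  calc ∑' m : ℕ, ∑' n : ℕ, (if gRoot p' n < gRoot p m then wMaj δ p p' (m, n) else 0)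
      ≤ ∑' m : ℕ, (p.2 : ℝ) ^ 2 * p'.2 / p.1 *
          (Real.exp (-ε * ((m : ℝ) + 1) ^ 2) * (Λ + Real.log ((m : ℝ) + 1)) / ((m : ℝ) + 1)) :=
        hsumfib.tsum_le_tsum hfib (hwsum.mul_left _)
    _ = (p.2 : ℝ) ^ 2 * p'.2 / p.1 *
          ∑' m : ℕ, Real.exp (-ε * ((m : ℝ) + 1) ^ 2) * (Λ + Real.log ((m : ℝ) + 1)) / ((m : ℝ) + 1) :=
        tsum_mul_left
    _ ≤ (p.2 : ℝ) ^ 2 * p'.2 / p.1 * (12 * (Λ + Real.log (cutM ε)) ^ 2) :=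
        mul_le_mul_of_nonneg_left hwle (by positivity)

/-- **Symmetry of the majorant**: `w_{p,p'}(m,n) = w_{p',p}(n,m)`. [folklore] -/
theorem wMaj_swap (δ : ℝ) (p p' : ℕ × ℕ) (mn : ℕ × ℕ) : wMaj δ p p' mn = wMaj δ p' p mn.swap := by
  unfold wMaj
  simp only [Prod.fst_swap, Prod.snd_swap]
  rw [abs_sub_comm (gFreq p mn.1), add_comm (gFreq p mn.1)]
  by_cases h : (mn.1 + 1) * p.1 * p'.2 = (mn.2 + 1) * p'.1 * p.2
  · rw [if_pos h, if_pos h.symm]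
  · rw [if_neg h, if_neg (fun h' ↦ h h'.symm)]

/-- **`∑ w = T₁(p,p') + T₁(p',p)`** (split into `√A > √B` and `√A < √B`; the diagonal carries
`w = 0`). [cite: Titchmarsh1986, §10.16] -/
theorem tsum_wMaj_eq (hδ : 0 < Real.sin δ) (hp : p ∈ mollRange X ×ˢ mollRange X)
    (hp' : p' ∈ mollRange X ×ˢ mollRange X) :
    ∑' mn : ℕ × ℕ, wMaj δ p p' mn = Tgt δ p p' + Tgt δ p' p := by
  have hsplit : ∀ mn : ℕ × ℕ, wMaj δ p p' mn =
      (if gRoot p' mn.2 < gRoot p mn.1 then wMaj δ p p' mn else 0) +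
        (if gRoot p mn.1 < gRoot p' mn.2 then wMaj δ p p' mn else 0) := by
    intro mn
    rcases lt_trichotomy (gRoot p' mn.2) (gRoot p mn.1) with h | h | h
    · rw [if_pos h, if_neg (not_lt.mpr h.le), add_zero]
    · have hdiag : (mn.1 + 1) * p.1 * p'.2 = (mn.2 + 1) * p'.1 * p.2 := (diag_iff hp hp' _ _).mpr h.symm
      rw [if_neg (by rw [h]; exact lt_irrefl _), if_neg (by rw [h]; exact lt_irrefl _), add_zero, wMaj, if_pos hdiag]
    · rw [if_neg (not_lt.mpr h.le), if_pos h, zero_add]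
  have hs2 : Summable fun mn : ℕ × ℕ ↦ if gRoot p mn.1 < gRoot p' mn.2 then wMaj δ p p' mn else 0 := by
    refine Summable.of_nonneg_of_le (fun mn ↦ ?_) (fun mn ↦ ?_) (summable_wMaj hδ hp hp')
    · have := wMaj_nonneg δ p p' mn; split_ifs <;> positivity
    · have := wMaj_nonneg δ p p' mn; split_ifs <;> linarith
  rw [tsum_congr hsplit, (summable_ugt hδ hp hp').tsum_add hs2, Tgt, Tgt]
  congr 1
  rw [← (Equiv.prodComm ℕ ℕ).tsum_eq]
  refine tsum_congr fun mn ↦ ?_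
  simp only [Equiv.prodComm_apply, Prod.fst_swap, Prod.snd_swap]
  rw [wMaj_swap δ p p' mn.swap, Prod.swap_swap]

end Tgt

/-! ## §7 The bound (10.16.1) -/

/-- `∑_{κ<X} 1/κ ≤ 2(1 + log X)` for `X ≥ 1`. [folklore] -/
theorem sum_mollRange_inv_le {X : ℝ} (hX : 1 ≤ X) : ∑ κ ∈ mollRange X, (κ : ℝ)⁻¹ ≤ 2 * (1 + Real.log X) := by
  have hsub : mollRange X ⊆ Finset.Icc 1 ⌈X⌉₊ := by
    intro κ hκ
    obtain ⟨h1, h2⟩ := mem_mollRange.mp hκ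
    exact Finset.mem_Icc.mpr ⟨h1, (Nat.lt_ceil.mpr h2).le⟩
  have hceil : (⌈X⌉₊ : ℝ) ≤ 2 * X := by have := Nat.ceil_lt_add_one (by linarith : (0:ℝ) ≤ X); linarith
  have hceil0 : (0 : ℝ) < ⌈X⌉₊ := by exact_mod_cast Nat.ceil_pos.mpr (by linarith)
  calc ∑ κ ∈ mollRange X, (κ : ℝ)⁻¹ ≤ ∑ κ ∈ Finset.Icc 1 ⌈X⌉₊, (κ : ℝ)⁻¹ :=
        Finset.sum_le_sum_of_subset_of_nonneg hsub fun κ _ _ ↦ by positivity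
    _ ≤ 1 + Real.log ⌈X⌉₊ := sum_Icc_inv_le_log _
    _ ≤ 1 + Real.log (2 * X) := by linarith [Real.log_le_log hceil0 hceil]
    _ = 1 + (Real.log 2 + Real.log X) := by rw [Real.log_mul (by norm_num) (by linarith)]
    _ ≤ 2 * (1 + Real.log X) := by
        have : Real.log 2 ≤ 1 := by have := Real.log_two_lt_d9; linarith
        linarith [Real.log_nonneg hX]

/-- `sin δ ≥ δ/2` and `cos δ ≥ ½` for `0 < δ ≤ 1`. [folklore] -/
theorem sin_cos_bounds {δ : ℝ} (hδ : 0 < δ) (hδ1 : δ ≤ 1) : δ / 2 ≤ Real.sin δ ∧ 1 / 2 ≤ Real.cos δ := by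
  constructor
  · have := Real.sin_gt_sub_cube hδ
    have hδ2 : δ ^ 2 ≤ 1 := pow_le_one₀ hδ.le hδ1
    nlinarith
  · have := Real.one_sub_sq_div_two_le_cos (x := δ)
    nlinarith

/-- Lower bound for `ε_p = π(κ/λ)² sin δ`: `ε_p ≥ δ/X²`. [folklore] -/
theorem eps_lower {X δ : ℝ} (hX0 : 0 < X) (hδ : 0 < δ) (hsin : δ / 2 ≤ Real.sin δ) {p : ℕ × ℕ}
    (hp : p ∈ mollRange X ×ˢ mollRange X) : δ / X ^ 2 ≤ π * ((p.1 : ℝ) / p.2) ^ 2 * Real.sin δ := by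
  obtain ⟨h1, h2⟩ := pos_of_mem_prod hp
  obtain ⟨_, hlX⟩ := lt_of_mem_prod hp
  have hκ1 : (1 : ℝ) ≤ p.1 := by exact_mod_cast (mem_mollRange.mp (Finset.mem_product.mp hp).1).1
  have hratio : X⁻¹ ≤ (p.1 : ℝ) / p.2 := by
    rw [inv_eq_one_div, div_le_div_iff₀ hX0 h2]; nlinarith
  have hratio2 : X⁻¹ ^ 2 ≤ ((p.1 : ℝ) / p.2) ^ 2 := pow_le_pow_left₀ (by positivity) hratio 2
  have hX2 : 0 < (X ^ 2)⁻¹ := by positivity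
  calc δ / X ^ 2 = X⁻¹ ^ 2 * δ := by rw [inv_pow, div_eq_mul_inv, mul_comm]
    _ ≤ X⁻¹ ^ 2 * (π * (δ / 2)) := by
        refine mul_le_mul_of_nonneg_left ?_ (by positivity)
        nlinarith [Real.pi_gt_three]
    _ ≤ ((p.1 : ℝ) / p.2) ^ 2 * (π * Real.sin δ) := by gcongr
    _ = π * ((p.1 : ℝ) / p.2) ^ 2 * Real.sin δ := by ring

/-- `log M₀(ε) ≤ 2 + log X + log(1/δ)` when `ε ≥ δ/X²`, `X ≥ 2`, `δ ≤ 1`. [folklore] -/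
theorem log_cutM_le {X δ ε : ℝ} (hX : 2 ≤ X) (hδ : 0 < δ) (hδ1 : δ ≤ 1) (hε : 0 < ε) (hεlow : δ / X ^ 2 ≤ ε) :
    Real.log (cutM ε) ≤ 2 + Real.log X + Real.log (1 / δ) := by
  have hX0 : 0 < X := by linarith
  obtain ⟨hM3, _, hM4⟩ := cutM_bounds hε
  have hM0 : (0 : ℝ) < cutM ε := by linarith
  set D : ℝ := (1 / δ) ^ (1 / 2 : ℝ) with hD
  have hD1 : 1 ≤ D := Real.one_le_rpow (by rw [le_div_iff₀ hδ]; linarith) (by norm_num)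
  have hεpow : ε ^ (-(1 / 2 : ℝ)) ≤ X * D := by
    have hdx : 0 < δ / X ^ 2 := by positivity
    calc ε ^ (-(1 / 2 : ℝ)) ≤ (δ / X ^ 2) ^ (-(1 / 2 : ℝ)) := Real.rpow_le_rpow_of_nonpos hdx hεlow (by norm_num)
      _ = X * D := by
          rw [Real.rpow_neg hdx.le, Real.div_rpow hδ.le (by positivity), show (X ^ 2 : ℝ) = X ^ (2 : ℝ) by norm_cast,
            ← Real.rpow_mul hX0.le, hD, Real.div_rpow zero_le_one hδ.le, Real.one_rpow]
          norm_num
          rw [div_eq_mul_inv]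
  have hXD : 2 ≤ X * D := by nlinarith
  have hbig : (cutM ε : ℝ) ≤ 3 * (X * D) := by linarith
  have hpos : 0 < X * D := by positivity
  calc Real.log (cutM ε) ≤ Real.log (3 * (X * D)) := Real.log_le_log hM0 hbig
    _ = Real.log 3 + (Real.log X + 1 / 2 * Real.log (1 / δ)) := by
        rw [Real.log_mul (by norm_num) hpos.ne', Real.log_mul hX0.ne' (by positivity), hD,
          Real.log_rpow (by positivity)]
    _ ≤ 2 + Real.log X + Real.log (1 / δ) := by
        have h3 : Real.log 3 ≤ 2 := by
          have h := Real.log_le_sub_one_of_pos (show (0:ℝ) < 3 by norm_num); linarith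
        have : 0 ≤ Real.log (1 / δ) := Real.log_nonneg (by rw [le_div_iff₀ hδ]; linarith)
        linarith

/-- **Step 3**: `|c_p c_{p'}| T₁(p,p') ≤ 108 L² λ/κ`, `L = 1 + log X + log(1/δ)`. [cite: Titchmarsh1986, §10.16] -/
theorem abs_coeff_mul_Tgt_le {X δ : ℝ} (hX : 2 ≤ X) (hδ : 0 < δ) (hδ1 : δ ≤ 1) {p p' : ℕ × ℕ}
    (hp : p ∈ mollRange X ×ˢ mollRange X) (hp' : p' ∈ mollRange X ×ˢ mollRange X) :
    |gCoeff X p * gCoeff X p'| * Tgt δ p p' ≤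
      108 * (1 + Real.log X + Real.log (1 / δ)) ^ 2 * ((p.2 : ℝ) / p.1) := by
  obtain ⟨hsin, _⟩ := sin_cos_bounds hδ hδ1
  have hsin0 : 0 < Real.sin δ := by linarith
  have hX0 : 0 < X := by linarith
  obtain ⟨h1, h2⟩ := pos_of_mem_prod hp
  obtain ⟨h1', h2'⟩ := pos_of_mem_prod hp'
  obtain ⟨hκX, _⟩ := lt_of_mem_prod hp
  obtain ⟨_, hνX⟩ := lt_of_mem_prod hp'
  have hκ1 : (1 : ℝ) ≤ p.1 := by exact_mod_cast (mem_mollRange.mp (Finset.mem_product.mp hp).1).1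
  have hν1 : (1 : ℝ) ≤ p'.2 := by exact_mod_cast (mem_mollRange.mp (Finset.mem_product.mp hp').2).1
  set L : ℝ := 1 + Real.log X + Real.log (1 / δ) with hL
  have hc : |gCoeff X p * gCoeff X p'| ≤ 1 / ((p.2 : ℝ) * p'.2) := by
    rw [abs_mul]
    calc |gCoeff X p| * |gCoeff X p'| ≤ (1 / p.2) * (1 / p'.2) :=
          mul_le_mul (abs_gCoeff_le hp) (abs_gCoeff_le hp') (abs_nonneg _) (by positivity)
      _ = 1 / ((p.2 : ℝ) * p'.2) := by rw [one_div_mul_one_div]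
  have hT := Tgt_le hsin0 hp hp'
  have hTnn : 0 ≤ Tgt δ p p' := tsum_nonneg fun mn ↦ (ugt_nonneg_le δ p p' mn).1
  set ε : ℝ := π * ((p.1 : ℝ) / p.2) ^ 2 * Real.sin δ with hε
  have hε0 : 0 < ε := by positivity
  have hlogM : Real.log (cutM ε) ≤ 2 + Real.log X + Real.log (1 / δ) :=
    log_cutM_le hX hδ hδ1 hε0 (eps_lower hX0 hδ hsin hp)
  have hlogκν : Real.log ((p.1 : ℝ) * p'.2) ≤ 2 * Real.log X := by
    have : (p.1 : ℝ) * p'.2 ≤ X ^ 2 := by nlinarith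
    calc Real.log ((p.1 : ℝ) * p'.2) ≤ Real.log (X ^ 2) := Real.log_le_log (by positivity) this
      _ = 2 * Real.log X := by rw [Real.log_pow]; push_cast; ring
  have hlogδ : 0 ≤ Real.log (1 / δ) := Real.log_nonneg (by rw [le_div_iff₀ hδ]; linarith)
  have hΛ : (1 + Real.log ((p.1 : ℝ) * p'.2)) + Real.log (cutM ε) ≤ 3 * L := by rw [hL]; linarith
  have hΛ0 : 0 ≤ (1 + Real.log ((p.1 : ℝ) * p'.2)) + Real.log (cutM ε) := by
    have : 0 ≤ Real.log ((p.1 : ℝ) * p'.2) := Real.log_nonneg (by nlinarith)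
    have : 0 ≤ Real.log (cutM ε) := Real.log_nonneg (by linarith [(cutM_bounds hε0).1])
    linarith
  have hsq : ((1 + Real.log ((p.1 : ℝ) * p'.2)) + Real.log (cutM ε)) ^ 2 ≤ (3 * L) ^ 2 :=
    pow_le_pow_left₀ hΛ0 hΛ 2
  calc |gCoeff X p * gCoeff X p'| * Tgt δ p p'
      ≤ (1 / ((p.2 : ℝ) * p'.2)) * ((p.2 : ℝ) ^ 2 * p'.2 / p.1 *
          (12 * ((1 + Real.log ((p.1 : ℝ) * p'.2)) + Real.log (cutM ε)) ^ 2)) :=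
        mul_le_mul hc hT hTnn (by positivity)
    _ ≤ (1 / ((p.2 : ℝ) * p'.2)) * ((p.2 : ℝ) ^ 2 * p'.2 / p.1 * (12 * (3 * L) ^ 2)) := by gcongr
    _ = 108 * L ^ 2 * ((p.2 : ℝ) / p.1) := by field_simp; ring

/-- **Step 4**: `∑_{p,p'} λ/κ ≤ 2X⁴(1 + log X)·` (crudely: `∑_{κλμν<X} λ/κ ≤ X²·X²·2(1+log X)`). [folklore] -/
theorem sum_ratio_le {X : ℝ} (hX : 1 ≤ X) :
    ∑ p ∈ mollRange X ×ˢ mollRange X, ∑ _p' ∈ mollRange X ×ˢ mollRange X, ((p.2 : ℝ) / p.1) ≤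
      2 * X ^ 4 * (1 + Real.log X) := by
  have hX0 : 0 < X := by linarith
  set R := mollRange X ×ˢ mollRange X with hR
  have hcard : ((mollRange X).card : ℝ) ≤ X := card_mollRange_le hX0.le
  have hcardR : (R.card : ℝ) ≤ X ^ 2 := by
    rw [hR, Finset.card_product]; push_cast; nlinarith
  have hlog : 0 ≤ 1 + Real.log X := by linarith [Real.log_nonneg hX]
  calc ∑ p ∈ R, ∑ _p' ∈ R, ((p.2 : ℝ) / p.1) = ∑ p ∈ R, R.card * ((p.2 : ℝ) / p.1) := by
        refine Finset.sum_congr rfl fun p _ ↦ ?_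
        rw [Finset.sum_const, nsmul_eq_mul]
    _ = R.card * ∑ p ∈ R, ((p.2 : ℝ) / p.1) := by rw [Finset.mul_sum]
    _ = R.card * ((∑ κ ∈ mollRange X, (κ : ℝ)⁻¹) * ∑ l ∈ mollRange X, (l : ℝ)) := by
        congr 1
        rw [hR, Finset.sum_product, Finset.sum_mul_sum]
        refine Finset.sum_congr rfl fun κ _ ↦ Finset.sum_congr rfl fun l _ ↦ ?_
        rw [div_eq_mul_inv, mul_comm]
    _ ≤ X ^ 2 * ((2 * (1 + Real.log X)) * (X * X)) := by
        have hs1 : 0 ≤ ∑ κ ∈ mollRange X, (κ : ℝ)⁻¹ := Finset.sum_nonneg fun _ _ ↦ by positivity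
        have hs2 : 0 ≤ ∑ l ∈ mollRange X, (l : ℝ) := Finset.sum_nonneg fun _ _ ↦ by positivity
        have hb1 := sum_mollRange_inv_le hX
        have hb2 : ∑ l ∈ mollRange X, (l : ℝ) ≤ X * X := by
          calc ∑ l ∈ mollRange X, (l : ℝ) ≤ ∑ _l ∈ mollRange X, X :=
                Finset.sum_le_sum fun l hl ↦ (mem_mollRange.mp hl).2.le
            _ = (mollRange X).card * X := by rw [Finset.sum_const, nsmul_eq_mul]
            _ ≤ X * X := by gcongr
        exact mul_le_mul hcardR (mul_le_mul hb1 hb2 hs2 (by positivity)) (mul_nonneg hs1 hs2) (by positivity)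
    _ = 2 * X ^ 4 * (1 + Real.log X) := by ring

/-- **Titchmarsh (10.16.1), the off-diagonal terms.** There is an absolute constant `C` with
`‖Σ₂‖ ≤ C X⁴ (1 + log X + log(1/δ))³ x^{-θ}` for `X ≥ 2`, `0 < δ ≤ 1`, `x ≥ 1`, `θ ≥ 0`
(Titchmarsh: `Σ₂ = O(X⁴ x^{-θ} log²(1/δ))` for `X = δ^{-c}`, `c ≤ 1/8`). [cite: Titchmarsh1986, §10.16 (10.16.1)] -/
theorem norm_Sigma2_le :
    ∃ C : ℝ, 0 < C ∧ ∀ X : ℝ, 2 ≤ X → ∀ δ : ℝ, 0 < δ → δ ≤ 1 → ∀ x : ℝ, 1 ≤ x → ∀ θ : ℝ, 0 ≤ θ →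
      ‖Sigma2 X δ x θ‖ ≤ C * X ^ 4 * (1 + Real.log X + Real.log (1 / δ)) ^ 3 * x ^ (-θ) := by
  refine ⟨1000, by norm_num, fun X hX δ hδ hδ1 x hx θ hθ ↦ ?_⟩
  obtain ⟨hsin, hcos⟩ := sin_cos_bounds hδ hδ1
  have hsin0 : 0 < Real.sin δ := by linarith
  have hcos0 : 0 < Real.cos δ := by linarith
  have hX1 : 1 ≤ X := by linarith
  have hX0 : 0 < X := by linarith
  set R := mollRange X ×ˢ mollRange X with hR
  set L : ℝ := 1 + Real.log X + Real.log (1 / δ) with hL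
  have hlogX : 0 ≤ Real.log X := Real.log_nonneg hX1
  have hlogδ : 0 ≤ Real.log (1 / δ) := Real.log_nonneg (by rw [le_div_iff₀ hδ]; linarith)
  have hL1 : 1 ≤ L := by linarith
  have hxθ : 0 < x ^ (-θ) := Real.rpow_pos_of_pos (by linarith) _
  -- Step 1: `‖Σ₂‖ ≤ ∑_{p,p'} (|c_p c_{p'}| x^{-θ}/(π cos δ)) ∑ w`
  have hstep1 : ‖Sigma2 X δ x θ‖ ≤ ∑ p ∈ R, ∑ p' ∈ R,
      |gCoeff X p * gCoeff X p'| * x ^ (-θ) / (π * Real.cos δ) * ∑' mn : ℕ × ℕ, wMaj δ p p' mn := by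
    rw [Sigma2]
    refine (norm_sum_le _ _).trans (Finset.sum_le_sum fun p hp ↦ ?_)
    refine (norm_sum_le _ _).trans (Finset.sum_le_sum fun p' hp' ↦ ?_)
    have hw := summable_wMaj hsin0 hp hp'
    have hbd := fun mn ↦ norm_Sigma2_term_le (X := X) hsin0 hcos0 hx hθ hp hp' mn
    have hns : Summable fun mn : ℕ × ℕ ↦ ‖(if (mn.1 + 1) * p.1 * p'.2 = (mn.2 + 1) * p'.1 * p.2 then (0 : ℂ)
        else ((gCoeff X p * gCoeff X p' : ℝ) : ℂ) * oscI (oscPhase δ (gFreq p mn.1) (gFreq p' mn.2)) x θ)‖ :=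
      Summable.of_nonneg_of_le (fun _ ↦ norm_nonneg _) hbd (hw.mul_left _)
    refine (norm_tsum_le_tsum_norm hns).trans ?_
    rw [← tsum_mul_left]
    exact hns.tsum_le_tsum hbd (hw.mul_left _)
  -- Step 2: symmetrise `∑ w = T₁(p,p') + T₁(p',p)`
  have hstep2 : ∑ p ∈ R, ∑ p' ∈ R, |gCoeff X p * gCoeff X p'| * x ^ (-θ) / (π * Real.cos δ) *
      ∑' mn : ℕ × ℕ, wMaj δ p p' mn =
      x ^ (-θ) / (π * Real.cos δ) * (2 * ∑ p ∈ R, ∑ p' ∈ R, |gCoeff X p * gCoeff X p'| * Tgt δ p p') := by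
    have h1 : ∑ p ∈ R, ∑ p' ∈ R, |gCoeff X p * gCoeff X p'| * x ^ (-θ) / (π * Real.cos δ) *
        ∑' mn : ℕ × ℕ, wMaj δ p p' mn =
        x ^ (-θ) / (π * Real.cos δ) * (∑ p ∈ R, ∑ p' ∈ R, |gCoeff X p * gCoeff X p'| * Tgt δ p p' +
          ∑ p ∈ R, ∑ p' ∈ R, |gCoeff X p * gCoeff X p'| * Tgt δ p' p) := by
      rw [← Finset.sum_add_distrib, Finset.mul_sum]
      refine Finset.sum_congr rfl fun p hp ↦ ?_
      rw [← Finset.sum_add_distrib, Finset.mul_sum]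
      refine Finset.sum_congr rfl fun p' hp' ↦ ?_
      rw [tsum_wMaj_eq hsin0 hp hp']
      ring
    have h2 : ∑ p ∈ R, ∑ p' ∈ R, |gCoeff X p * gCoeff X p'| * Tgt δ p' p =
        ∑ p ∈ R, ∑ p' ∈ R, |gCoeff X p * gCoeff X p'| * Tgt δ p p' := by
      rw [Finset.sum_comm]
      refine Finset.sum_congr rfl fun p _ ↦ Finset.sum_congr rfl fun p' _ ↦ ?_
      rw [mul_comm (gCoeff X p')]
    rw [h1, h2, two_mul]
  -- Steps 3–4
  have hsum3 : ∑ p ∈ R, ∑ p' ∈ R, |gCoeff X p * gCoeff X p'| * Tgt δ p p' ≤ 108 * L ^ 2 * (2 * X ^ 4 * (1 + Real.log X)) := by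
    calc ∑ p ∈ R, ∑ p' ∈ R, |gCoeff X p * gCoeff X p'| * Tgt δ p p'
        ≤ ∑ p ∈ R, ∑ p' ∈ R, 108 * L ^ 2 * ((p.2 : ℝ) / p.1) :=
          Finset.sum_le_sum fun p hp ↦ Finset.sum_le_sum fun p' hp' ↦ abs_coeff_mul_Tgt_le hX hδ hδ1 hp hp'
      _ = 108 * L ^ 2 * ∑ p ∈ R, ∑ _p' ∈ R, ((p.2 : ℝ) / p.1) := by
          rw [Finset.mul_sum]; exact Finset.sum_congr rfl fun p _ ↦ by rw [Finset.mul_sum]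
      _ ≤ 108 * L ^ 2 * (2 * X ^ 4 * (1 + Real.log X)) :=
          mul_le_mul_of_nonneg_left (sum_ratio_le hX1) (by positivity)
  have hlogL : 1 + Real.log X ≤ L := by rw [hL]; linarith
  rw [hstep2] at hstep1
  refine hstep1.trans ?_
  have hπcos : 1 ≤ π * Real.cos δ := by nlinarith [Real.pi_gt_three]
  have hSnn : 0 ≤ ∑ p ∈ R, ∑ p' ∈ R, |gCoeff X p * gCoeff X p'| * Tgt δ p p' :=
    Finset.sum_nonneg fun p _ ↦ Finset.sum_nonneg fun p' _ ↦
      mul_nonneg (abs_nonneg _) (tsum_nonneg fun mn ↦ (ugt_nonneg_le δ p p' mn).1)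
  have hfrac : x ^ (-θ) / (π * Real.cos δ) ≤ x ^ (-θ) := div_le_self hxθ.le hπcos
  calc x ^ (-θ) / (π * Real.cos δ) * (2 * ∑ p ∈ R, ∑ p' ∈ R, |gCoeff X p * gCoeff X p'| * Tgt δ p p')
      ≤ x ^ (-θ) * (2 * (108 * L ^ 2 * (2 * X ^ 4 * (1 + Real.log X)))) :=
        mul_le_mul hfrac (by linarith) (by positivity) hxθ.le
    _ ≤ x ^ (-θ) * (2 * (108 * L ^ 2 * (2 * X ^ 4 * L))) := by gcongr
    _ = 432 * X ^ 4 * L ^ 3 * x ^ (-θ) := by ring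
    _ ≤ 1000 * X ^ 4 * L ^ 3 * x ^ (-θ) := by
        have : 0 ≤ X ^ 4 * L ^ 3 * x ^ (-θ) := by positivity
        nlinarith

end Literature.NumberTheory.LFunctions.SelbergMollifier
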